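import Mathlib.NumberTheory.NumberField.House
import Mathlib.NumberTheory.NumberField.InfinitePlace.Embeddings
import Mathlib.FieldTheory.Minpoly.IsIntegrallyClosed
import Mathlib.RingTheory.IntegralClosure.IsIntegralClosure.Basic
import Mathlib.FieldTheory.IntermediateField.Adjoin.Basic
import Mathlib.Analysis.Complex.Basic
import HarnessLib

/-!
# Baker 1975, Ch. 3 — arithmetic preliminaries (heights, sizes, denominators)

Support for the proof of Theorem 3.1 of A. Baker, *Transcendental Number Theory* (1975), Ch. 3
(`Literature.NumberTheory.Transcendental.baker1975_thm_3_1`). This file collects the elementary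
arithmetic of algebraic numbers used in the proof (Ch. 2 §3, eq. (2), p. 20, and Ch. 3 §2,
"preliminary observations concerning the heights of algebraic numbers", p. 29), in a form that is
UNIFORM in the varying coefficients `β` — all constants are explicit:

* `redCoeff`, `pow_mul_pow_eq_sum_redCoeff`, `abs_redCoeff_le` — **Baker's reduction (2)**
  (p. 20): if `P(θ) = 0`, `P ∈ ℤ[X]` of degree `e ≥ 1` with leading coefficient `a` and height
  `≤ H`, then `aʲ θʲ = ∑_{t<e} c_{j,t} θᵗ` with integers `|c_{j,t}| ≤ (2H)ʲ` — the device by which the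
  Siegel system gets INTEGER coefficients without an integral basis;
* `norm_le_of_aeval_eq_zero` — Cauchy's bound: a complex root of a non-zero integer polynomial of
  height `≤ H` has absolute value `≤ H + 1` (so every conjugate of `β` is `≤ B + 1`, p. 29:
  "`|α| ≤ dH`");
* `norm_aeval_le` — `|P(z)| ≤ (deg P + 1) H max(1,|z|)^{deg P}`;
* for an element `x` of a number field `K` with a denominator `b` (`b x ∈ 𝓞_K`) and all conjugates
  `≤ M`: `exists_intPoly_of_isIntegral_mul` — a non-zero `Q ∈ ℤ[X]` of degree `≤ [K:ℚ]` and height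
  `≤ (2b²M)^{[K:ℚ]}` with `Q(x) = 0` (from the minimal polynomial of `b x` and Mathlib's
  `NumberField.Embeddings.coeff_bdd_of_norm_le`); `liouville_lower_bound` — **the Liouville
  (norm) inequality** `|σ x| ≥ (b^{[K:ℚ]} M^{[K:ℚ]-1})⁻¹` for `x ≠ 0`;
  `exists_den_inv` — a denominator and a conjugate bound for `x⁻¹`;
* `finrank_adjoin_le_prod_natDegree` — `[ℚ(x₁,…,x_m) : ℚ] ≤ ∏ deg Pᵢ` for witnesses `Pᵢ(xᵢ) = 0`.

Everything here is proved.

## References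

* A. Baker, *Transcendental Number Theory*, Cambridge Univ. Press 1975, Ch. 2 §3 (eq. (2), p. 20),
  Ch. 3 §2 (p. 29). [BakerTNT1975]
-/

noncomputable section

open Finset Polynomial

namespace Literature.NumberTheory.Transcendental.Baker1975.Ch3

/-! ### Baker's reduction of powers (Ch. 2, eq. (2)) -/

/-- **Baker's coefficients `a^{(j)}_t`** (Baker 1975, p. 20, eq. (2)): for `P ∈ ℤ[X]` with leading
coefficient `a` and degree `e`, the integers `c_{j,t}` with `aʲ θʲ = ∑_{t<e} c_{j,t} θᵗ` whenever
`P(θ) = 0`, defined by the recursion `c_{0,t} = δ_{t,0}`,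
`c_{j+1,t} = a c_{j,t-1} [t ≥ 1] - c_{j,e-1} P_t`. [cite: BakerTNT1975, Ch. 2 §3, eq. (2)] -/
def redCoeff (P : ℤ[X]) : ℕ → ℕ → ℤ
  | 0, t => if t = 0 then 1 else 0
  | j + 1, t => (if t = 0 then 0 else P.leadingCoeff * redCoeff P j (t - 1)) -
      redCoeff P j (P.natDegree - 1) * P.coeff t

/-- The recursion unfolded at `0`. [folklore] -/
@[simp] theorem redCoeff_zero (P : ℤ[X]) (t : ℕ) : redCoeff P 0 t = if t = 0 then 1 else 0 := by
  rw [redCoeff]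

/-- The recursion unfolded at `j + 1`. [folklore] -/
theorem redCoeff_succ (P : ℤ[X]) (j t : ℕ) : redCoeff P (j + 1) t =
    (if t = 0 then 0 else P.leadingCoeff * redCoeff P j (t - 1)) -
      redCoeff P j (P.natDegree - 1) * P.coeff t := by
  rw [redCoeff]

/-- **Baker's reduction of powers** (Baker 1975, p. 20, (2)): if `P(θ) = 0` in a commutative ring,
`deg P = e ≥ 1`, `a` the leading coefficient, then `aʲ θʲ = ∑_{t<e} c_{j,t} θᵗ` for all `j`.
[cite: BakerTNT1975, Ch. 2 §3, eq. (2)] -/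
theorem pow_mul_pow_eq_sum_redCoeff {R : Type*} [CommRing R] (P : ℤ[X]) (he : 1 ≤ P.natDegree)
    (θ : R) (hθ : aeval θ P = 0) (j : ℕ) :
    (P.leadingCoeff : R) ^ j * θ ^ j =
      ∑ t ∈ range P.natDegree, (redCoeff P j t : R) * θ ^ t := by
  obtain ⟨e, he'⟩ : ∃ e, P.natDegree = e + 1 := ⟨P.natDegree - 1, by omega⟩
  -- the relation `a θ^{e+1} = - ∑_{t ≤ e} P_t θ^t`
  have hrel : (P.leadingCoeff : R) * θ ^ (e + 1) = -∑ t ∈ range (e + 1), (P.coeff t : R) * θ ^ t := by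
    have h1 : aeval θ P = ∑ t ∈ range (P.natDegree + 1), (P.coeff t : R) * θ ^ t := by
      rw [aeval_eq_sum_range]
      simp [Algebra.smul_def]
    rw [hθ, he', Finset.sum_range_succ] at h1
    rw [leadingCoeff, he']
    linear_combination -h1
  induction j with
  | zero =>
    rw [he']
    simp
  | succ j ih =>
    rw [he'] at ih ⊢
    simp only [redCoeff_succ, he', Nat.add_sub_cancel, Int.cast_sub, Int.cast_mul, sub_mul,
      Finset.sum_sub_distrib, Int.cast_ite, Int.cast_zero]
    -- first sum: shift the index
    have h1 : ∑ t ∈ range (e + 1), (if t = 0 then (0 : R) else (P.leadingCoeff : R) * (redCoeff P j (t - 1) : R)) * θ ^ t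
        = (P.leadingCoeff : R) * ∑ t ∈ range e, (redCoeff P j t : R) * θ ^ (t + 1) := by
      rw [Finset.sum_range_succ', Finset.mul_sum]
      simp only [Nat.succ_ne_zero, if_false, Nat.add_sub_cancel, if_true, zero_mul, add_zero]
      exact Finset.sum_congr rfl fun t _ => by ring
    -- second sum: the relation
    have h2 : ∑ t ∈ range (e + 1), (redCoeff P j e : R) * (P.coeff t : R) * θ ^ t =
        -((redCoeff P j e : R) * ((P.leadingCoeff : R) * θ ^ (e + 1))) := by
      rw [hrel, mul_neg, neg_neg, Finset.mul_sum]
      exact Finset.sum_congr rfl fun t _ => by ring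
    rw [h1, h2, sub_neg_eq_add]
    -- recombine: `a (∑_{t<e} c_t θ^{t+1} + c_e θ^{e+1}) = a θ · a^j θ^j`
    have h3 : (P.leadingCoeff : R) * ∑ t ∈ range e, (redCoeff P j t : R) * θ ^ (t + 1) +
        (redCoeff P j e : R) * ((P.leadingCoeff : R) * θ ^ (e + 1)) =
        (P.leadingCoeff : R) * θ * ∑ t ∈ range (e + 1), (redCoeff P j t : R) * θ ^ t := by
      rw [Finset.sum_range_succ, mul_add, Finset.mul_sum, Finset.mul_sum]
      congr 1
      · exact Finset.sum_congr rfl fun t _ => by ring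
      · ring
    rw [h3, ← ih]; ring

/-- **The size of Baker's coefficients**: `|c_{j,t}| ≤ (2H)ʲ` for `t < e`, if all `|P_i| ≤ H`.
[cite: BakerTNT1975, Ch. 2 §3, eq. (2)] -/
theorem abs_redCoeff_le (P : ℤ[X]) {H : ℝ} (hH : ∀ i, |(P.coeff i : ℝ)| ≤ H) (j : ℕ) :
    ∀ t, t < P.natDegree → |(redCoeff P j t : ℝ)| ≤ (2 * H) ^ j := by
  have hH0 : 0 ≤ H := (abs_nonneg _).trans (hH 0)
  have hlead : |(P.leadingCoeff : ℝ)| ≤ H := hH _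
  induction j with
  | zero => intro t _; simp only [redCoeff_zero]; split_ifs <;> simp
  | succ j ih =>
    intro t ht
    rw [redCoeff_succ]
    push_cast
    have h1 : |(redCoeff P j (P.natDegree - 1) : ℝ)| ≤ (2 * H) ^ j := ih _ (by omega)
    have h2 : |(if t = 0 then (0 : ℝ) else (P.leadingCoeff : ℝ) * (redCoeff P j (t - 1) : ℝ))|
        ≤ H * (2 * H) ^ j := by
      split_ifs with h0
      · simp; positivity
      · rw [abs_mul]
        exact mul_le_mul hlead (ih _ (by omega)) (abs_nonneg _) hH0
    calc |(if t = 0 then (0 : ℝ) else (P.leadingCoeff : ℝ) * (redCoeff P j (t - 1) : ℝ)) -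
          (redCoeff P j (P.natDegree - 1) : ℝ) * (P.coeff t : ℝ)|
        ≤ |(if t = 0 then (0 : ℝ) else (P.leadingCoeff : ℝ) * (redCoeff P j (t - 1) : ℝ))| +
          |(redCoeff P j (P.natDegree - 1) : ℝ) * (P.coeff t : ℝ)| := abs_sub _ _
      _ ≤ H * (2 * H) ^ j + (2 * H) ^ j * H := by
          rw [abs_mul]
          exact add_le_add h2 (mul_le_mul h1 (hH t) (abs_nonneg _) (by positivity))
      _ = (2 * H) ^ (j + 1) := by ring

/-! ### Sizes of values and roots of integer polynomials -/

/-- `|P(z)| ≤ (deg P + 1) · H · max(1,|z|)^{deg P}` for an integer polynomial of height `≤ H`.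
[folklore] -/
theorem norm_aeval_le (P : ℤ[X]) {H : ℝ} (hH : ∀ i, |(P.coeff i : ℝ)| ≤ H) (z : ℂ) :
    ‖aeval z P‖ ≤ (P.natDegree + 1) * H * max 1 ‖z‖ ^ P.natDegree := by
  have hH0 : 0 ≤ H := (abs_nonneg _).trans (hH 0)
  have hz1 : (1 : ℝ) ≤ max 1 ‖z‖ := le_max_left _ _
  rw [aeval_eq_sum_range]
  calc ‖∑ i ∈ range (P.natDegree + 1), P.coeff i • z ^ i‖
      ≤ ∑ i ∈ range (P.natDegree + 1), ‖P.coeff i • z ^ i‖ := norm_sum_le _ _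
    _ ≤ ∑ _i ∈ range (P.natDegree + 1), H * max 1 ‖z‖ ^ P.natDegree := by
        refine Finset.sum_le_sum fun i hi => ?_
        rw [zsmul_eq_mul, norm_mul, norm_pow, Complex.norm_intCast]
        refine mul_le_mul (hH i) ?_ (by positivity) hH0
        exact (pow_le_pow_left₀ (norm_nonneg _) (le_max_right _ _) _).trans
          (pow_le_pow_right₀ hz1 (by simpa [Nat.lt_succ_iff] using hi))
    _ = (P.natDegree + 1) * H * max 1 ‖z‖ ^ P.natDegree := by
        rw [Finset.sum_const, Finset.card_range, nsmul_eq_mul]; push_cast; ring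

/-- **Cauchy's bound for integer polynomials**: a complex root of a non-zero `P ∈ ℤ[X]` of height
`≤ H` has absolute value `≤ H + 1` (the leading coefficient is a non-zero integer). This gives the
uniform bound for all conjugates of an algebraic number of height `≤ H` (Baker 1975, p. 29:
"if `α` is an algebraic number with degree `d` and height `H` then `|α| ≤ dH`").
[cite: BakerTNT1975, Ch. 3 §2 (p. 29)] -/
theorem norm_le_of_aeval_eq_zero {P : ℤ[X]} (hP : P ≠ 0) {H : ℝ} (hH : ∀ i, |(P.coeff i : ℝ)| ≤ H)
    {z : ℂ} (hz : aeval z P = 0) : ‖z‖ ≤ H + 1 := by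
  have hH0 : 0 ≤ H := (abs_nonneg _).trans (hH 0)
  by_cases hz1 : ‖z‖ ≤ 1
  · linarith
  push Not at hz1
  have hlead : (1 : ℝ) ≤ |(P.leadingCoeff : ℝ)| := by
    have : P.leadingCoeff ≠ 0 := leadingCoeff_ne_zero.mpr hP
    exact_mod_cast Int.one_le_abs this
  -- `a_e z^e = - ∑_{i<e} a_i z^i`
  have hsum : (P.leadingCoeff : ℂ) * z ^ P.natDegree =
      -∑ i ∈ range P.natDegree, (P.coeff i : ℂ) * z ^ i := by
    have h1 : aeval z P = ∑ i ∈ range (P.natDegree + 1), (P.coeff i : ℂ) * z ^ i := by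
      rw [aeval_eq_sum_range]; simp [Algebra.smul_def]
    rw [hz, Finset.sum_range_succ] at h1
    rw [leadingCoeff]
    linear_combination -h1
  -- take norms
  have h2 : ‖z‖ ^ P.natDegree ≤ H * ∑ i ∈ range P.natDegree, ‖z‖ ^ i := by
    have h3 : ‖(P.leadingCoeff : ℂ) * z ^ P.natDegree‖ ≤ ∑ i ∈ range P.natDegree, H * ‖z‖ ^ i := by
      rw [hsum, norm_neg]
      refine (norm_sum_le _ _).trans (Finset.sum_le_sum fun i _ => ?_)
      rw [norm_mul, norm_pow, Complex.norm_intCast]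
      exact mul_le_mul_of_nonneg_right (hH i) (by positivity)
    rw [norm_mul, norm_pow, Complex.norm_intCast, ← Finset.mul_sum] at h3
    calc ‖z‖ ^ P.natDegree = 1 * ‖z‖ ^ P.natDegree := (one_mul _).symm
      _ ≤ |(P.leadingCoeff : ℝ)| * ‖z‖ ^ P.natDegree :=
          mul_le_mul_of_nonneg_right hlead (by positivity)
      _ ≤ H * ∑ i ∈ range P.natDegree, ‖z‖ ^ i := h3
  -- geometric sum
  have hgeom : (∑ i ∈ range P.natDegree, ‖z‖ ^ i) * (‖z‖ - 1) = ‖z‖ ^ P.natDegree - 1 :=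
    geom_sum_mul ‖z‖ P.natDegree
  have hr1 : 0 < ‖z‖ - 1 := by linarith
  have hpos : 0 < ‖z‖ ^ P.natDegree := pow_pos (lt_trans zero_lt_one hz1) _
  have h4 : ‖z‖ ^ P.natDegree * (‖z‖ - 1) ≤ H * (‖z‖ ^ P.natDegree - 1) := by
    calc ‖z‖ ^ P.natDegree * (‖z‖ - 1) ≤ (H * ∑ i ∈ range P.natDegree, ‖z‖ ^ i) * (‖z‖ - 1) :=
          mul_le_mul_of_nonneg_right h2 hr1.le
      _ = H * (‖z‖ ^ P.natDegree - 1) := by rw [mul_assoc, hgeom]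
  -- from `r^e (r - 1) ≤ H r^e - H` we get `r - 1 ≤ H`
  have h6 : ‖z‖ ^ P.natDegree * (‖z‖ - 1) ≤ ‖z‖ ^ P.natDegree * H := by nlinarith
  have h7 : ‖z‖ - 1 ≤ H := le_of_mul_le_mul_left h6 hpos
  linarith

/-- The rescaled polynomial `Q(X) = m(bX)` written out: `∑ mᵢ bⁱ Xⁱ`. [folklore] -/
def scaleVar (m : ℤ[X]) (b : ℤ) : ℤ[X] :=
  ∑ i ∈ range (m.natDegree + 1), C (m.coeff i * b ^ i) * X ^ i

/-- The coefficients of `scaleVar m b`. [folklore] -/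
theorem coeff_scaleVar (m : ℤ[X]) (b : ℤ) (i : ℕ) : (scaleVar m b).coeff i = m.coeff i * b ^ i := by
  unfold scaleVar
  rw [finsetSum_coeff]
  simp only [coeff_C_mul_X_pow]
  rw [Finset.sum_eq_single i]
  · simp
  · intro j _ hji; rw [if_neg (Ne.symm hji)]
  · intro hi
    have : m.coeff i = 0 := coeff_eq_zero_of_natDegree_lt (by simpa [Nat.lt_succ_iff] using hi)
    simp [this]

/-- `scaleVar m b (x) = m (b x)`. [folklore] -/
theorem aeval_scaleVar {R : Type*} [CommRing R] (m : ℤ[X]) (b : ℤ) (x : R) :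
    aeval x (scaleVar m b) = aeval ((b : R) * x) m := by
  unfold scaleVar
  rw [map_sum, aeval_eq_sum_range]
  refine Finset.sum_congr rfl fun i _ => ?_
  simp [Algebra.smul_def, mul_pow]; ring

/-- `deg scaleVar ≤ deg m`. [folklore] -/
theorem natDegree_scaleVar_le (m : ℤ[X]) (b : ℤ) : (scaleVar m b).natDegree ≤ m.natDegree := by
  unfold scaleVar
  refine (natDegree_sum_le _ _).trans (Finset.sup_le fun i hi => ?_)
  refine (natDegree_C_mul_X_pow_le _ _).trans ?_
  simpa [Nat.lt_succ_iff] using hi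

/-- `scaleVar m b ≠ 0` for `m ≠ 0`, `b ≠ 0`. [folklore] -/
theorem scaleVar_ne_zero {m : ℤ[X]} (hm : m ≠ 0) {b : ℤ} (hb : b ≠ 0) : scaleVar m b ≠ 0 := by
  intro h
  have := congrArg (fun p => p.coeff m.natDegree) h
  simp only [coeff_scaleVar, coeff_zero, coeff_natDegree, mul_eq_zero] at this
  rcases this with h1 | h1
  · exact hm (leadingCoeff_eq_zero.mp h1)
  · exact (pow_ne_zero _ hb) h1

/-! ### Elements of a number field with a denominator and bounded conjugates -/

section NumberField

open NumberField Module

variable {K : Type*} [Field K] [NumberField K]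

/-- The degree of the minimal polynomial over `ℤ` of an algebraic integer of `K` is `≤ [K:ℚ]`.
[folklore] -/
theorem natDegree_minpoly_int_le {y : K} (hint : IsIntegral ℤ y) :
    (minpoly ℤ y).natDegree ≤ finrank ℚ K := by
  have hmQ : minpoly ℚ y = (minpoly ℤ y).map (algebraMap ℤ ℚ) :=
    minpoly.isIntegrallyClosed_eq_field_fractions' ℚ hint
  have h1 : (minpoly ℚ y).natDegree ≤ finrank ℚ K := minpoly.natDegree_le y
  rwa [hmQ, natDegree_map_eq_of_injective (algebraMap ℤ ℚ).injective_int] at h1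

/-- **Size of the minimal polynomial**: if all conjugates of the algebraic integer `y` are `≤ M`
(`M ≥ 1`) then the coefficients of its minimal polynomial over `ℤ` are `≤ (2M)^{[K:ℚ]}` in absolute
value (they are elementary symmetric functions of the conjugates; Mathlib's
`NumberField.Embeddings.coeff_bdd_of_norm_le`). [folklore] -/
theorem abs_coeff_minpoly_int_le {y : K} (hint : IsIntegral ℤ y) {M : ℝ} (hM1 : 1 ≤ M)
    (hM : ∀ φ : K →+* ℂ, ‖φ y‖ ≤ M) (i : ℕ) :
    |((minpoly ℤ y).coeff i : ℝ)| ≤ (2 * M) ^ finrank ℚ K := by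
  set D := finrank ℚ K with hD
  have hmQ : minpoly ℚ y = (minpoly ℤ y).map (algebraMap ℤ ℚ) :=
    minpoly.isIntegrallyClosed_eq_field_fractions' ℚ hint
  have h1 := NumberField.Embeddings.coeff_bdd_of_norm_le (K := K) (A := ℂ) hM i
  rw [hmQ, coeff_map, max_eq_left hM1] at h1
  have h2 : ‖(algebraMap ℤ ℚ) ((minpoly ℤ y).coeff i)‖ = |((minpoly ℤ y).coeff i : ℝ)| := by
    rw [algebraMap_int_eq, eq_intCast, Int.norm_cast_rat, Int.norm_eq_abs]
  rw [h2] at h1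
  have h3 : ((D.choose (D / 2) : ℕ) : ℝ) ≤ 2 ^ D := by exact_mod_cast Nat.choose_le_two_pow D (D / 2)
  calc |((minpoly ℤ y).coeff i : ℝ)| ≤ M ^ D * (D.choose (D / 2) : ℕ) := h1
    _ ≤ M ^ D * 2 ^ D := mul_le_mul_of_nonneg_left h3 (by positivity)
    _ = (2 * M) ^ D := by rw [mul_pow]; ring

/-- **From a denominator and a size to an integer polynomial** (the witness used in the Siegel step):
if `b x ∈ 𝓞_K` (`b ≥ 1`) and all conjugates of `x` are `≤ M` (`M ≥ 1`), then `x` is a root of a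
non-zero `Q ∈ ℤ[X]` of degree `≤ [K:ℚ]` and height `≤ (2 b² M)^{[K:ℚ]}` (namely `Q(X) = m(bX)`, `m`
the minimal polynomial of `b x`). (Baker 1975, p. 29: heights of `αβ`, `α + β` are bounded by a
power of the heights — here in the form needed, through the field `K`.) [cite: BakerTNT1975, Ch. 3 §2 (p. 29)] -/
theorem exists_intPoly_of_isIntegral_mul (x : K) {b : ℕ} (hb : 1 ≤ b)
    (hint : IsIntegral ℤ ((b : K) * x)) {M : ℝ} (hM1 : 1 ≤ M) (hM : ∀ φ : K →+* ℂ, ‖φ x‖ ≤ M) :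
    ∃ Q : ℤ[X], Q ≠ 0 ∧ Q.natDegree ≤ finrank ℚ K ∧
      (∀ i, |(Q.coeff i : ℝ)| ≤ (2 * b * b * M) ^ finrank ℚ K) ∧ aeval x Q = 0 := by
  set D := finrank ℚ K with hD
  set y : K := (b : K) * x with hy
  set m := minpoly ℤ y with hm
  have hb0 : (0 : ℝ) < b := by exact_mod_cast hb
  have hb1 : (1 : ℝ) ≤ b := by exact_mod_cast hb
  have hconj : ∀ φ : K →+* ℂ, ‖φ y‖ ≤ b * M := fun φ => by
    rw [hy, map_mul, map_natCast, norm_mul, Complex.norm_natCast]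
    exact mul_le_mul_of_nonneg_left (hM φ) (Nat.cast_nonneg _)
  have hbM1 : (1 : ℝ) ≤ b * M := by nlinarith
  have hcoeff : ∀ i, |(m.coeff i : ℝ)| ≤ (2 * (b * M)) ^ D := fun i =>
    abs_coeff_minpoly_int_le hint hbM1 hconj i
  have hdeg : m.natDegree ≤ D := natDegree_minpoly_int_le hint
  have hm0 : m ≠ 0 := minpoly.ne_zero hint
  refine ⟨scaleVar m b, scaleVar_ne_zero hm0 (by exact_mod_cast (show b ≠ 0 by omega)),
    (natDegree_scaleVar_le m b).trans hdeg, fun i => ?_, ?_⟩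
  · rw [coeff_scaleVar]
    push_cast
    rw [abs_mul, abs_pow, Nat.abs_cast]
    by_cases hi : i ≤ m.natDegree
    · calc |(m.coeff i : ℝ)| * (b : ℝ) ^ i ≤ (2 * (b * M)) ^ D * (b : ℝ) ^ D :=
            mul_le_mul (hcoeff i) (pow_le_pow_right₀ hb1 (hi.trans hdeg)) (by positivity)
              (by positivity)
        _ = (2 * b * b * M) ^ D := by rw [← mul_pow]; ring
    · rw [coeff_eq_zero_of_natDegree_lt (by omega)]
      simp; positivity
  · rw [aeval_scaleVar]
    push_cast
    exact minpoly.aeval ℤ y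

/-- `house x ≤ M` from a bound on all conjugates. [folklore] -/
theorem house_le_of_forall_norm_le {x : K} {M : ℝ} (hM0 : 0 ≤ M)
    (hM : ∀ φ : K →+* ℂ, ‖φ x‖ ≤ M) : house x ≤ M := by
  rw [house, pi_norm_le_iff_of_nonneg hM0]
  intro φ
  exact hM φ

/-- **The Liouville (norm) inequality with explicit constants**: if `x ≠ 0`, `b x ∈ 𝓞_K` (`b ≥ 1`)
and all conjugates of `x` are `≤ M` (`M ≥ 1`), then for every embedding `σ : K → ℂ`,
`|σ x| ≥ (b^{[K:ℚ]} M^{[K:ℚ]-1})⁻¹` — the norm of the algebraic integer `b x` is a non-zero rational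
integer (Baker 1975, p. 23 and p. 34: "either `Q = 0` or `|Q| ≥ …`").
[cite: BakerTNT1975, Ch. 3 §3 Lemma 5] -/
theorem liouville_lower_bound (σ : K →+* ℂ) {x : K} (hx : x ≠ 0) {b : ℕ} (hb : 1 ≤ b)
    (hint : IsIntegral ℤ ((b : K) * x)) {M : ℝ} (hM1 : 1 ≤ M) (hM : ∀ φ : K →+* ℂ, ‖φ x‖ ≤ M) :
    ((b : ℝ) ^ finrank ℚ K * M ^ (finrank ℚ K - 1))⁻¹ ≤ ‖σ x‖ := by
  set D := finrank ℚ K with hD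
  have hD1 : 1 ≤ D := finrank_pos
  have hb0 : (0 : ℝ) < b := by exact_mod_cast hb
  set y : K := (b : K) * x with hy
  have hy0 : y ≠ 0 := mul_ne_zero (by exact_mod_cast (show b ≠ 0 by omega)) hx
  set y₀ : 𝓞 K := ⟨y, hint⟩ with hy₀
  have hy₀0 : y₀ ≠ 0 := by
    intro h
    apply hy0
    calc y = (y₀ : K) := rfl
      _ = ((0 : 𝓞 K) : K) := by rw [h]
      _ = 0 := by simp
  -- `1 ≤ |N(y)|`
  have h1 : (1 : ℝ) ≤ ‖Algebra.norm ℚ y‖ := by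
    have hcoe : (y₀ : K) = y := rfl
    rw [← hcoe, ← Algebra.coe_norm_int]
    have hn : Algebra.norm ℤ y₀ ≠ 0 := Algebra.norm_ne_zero_iff.mpr hy₀0
    rw [Int.norm_cast_rat, Int.norm_eq_abs]
    exact_mod_cast Int.one_le_abs hn
  -- `|N(y)| ≤ |σ y| house(y)^{D-1}` and `house y ≤ b M`
  have h2 := NumberField.norm_norm_le_norm_mul_house_pow y σ
  have hconj : ∀ φ : K →+* ℂ, ‖φ y‖ ≤ b * M := fun φ => by
    rw [hy, map_mul, map_natCast, norm_mul, Complex.norm_natCast]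
    exact mul_le_mul_of_nonneg_left (hM φ) (Nat.cast_nonneg _)
  have hhouse : house y ≤ b * M := house_le_of_forall_norm_le (by positivity) hconj
  have h3 : (1 : ℝ) ≤ ‖σ y‖ * (b * M) ^ (D - 1) := by
    calc (1 : ℝ) ≤ ‖σ y‖ * house y ^ (D - 1) := h1.trans h2
      _ ≤ ‖σ y‖ * (b * M) ^ (D - 1) :=
          mul_le_mul_of_nonneg_left (pow_le_pow_left₀ (house_nonneg _) hhouse _) (norm_nonneg _)
  have hσy : ‖σ y‖ = b * ‖σ x‖ := by
    rw [hy, map_mul, map_natCast, norm_mul, Complex.norm_natCast]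
  rw [hσy] at h3
  have hpos : (0 : ℝ) < (b : ℝ) ^ D * M ^ (D - 1) := by positivity
  rw [inv_le_iff_one_le_mul₀ hpos]
  have hbD : (b : ℝ) ^ D = b * (b : ℝ) ^ (D - 1) := by
    rw [← pow_succ']; congr 1; omega
  calc (1 : ℝ) ≤ b * ‖σ x‖ * (b * M) ^ (D - 1) := h3
    _ = ‖σ x‖ * ((b : ℝ) ^ D * M ^ (D - 1)) := by rw [hbD, mul_pow]; ring

/-- **A denominator and a size for the inverse** of a non-zero algebraic integer `y` all of whose
conjugates are `≤ M` (`M ≥ 1`): with `c = m(0) ≠ 0` the constant coefficient of the minimal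
polynomial `m` of `y`, `|c| ≤ (2M)^{[K:ℚ]}`, `c y⁻¹ ∈ 𝓞_K`, and all conjugates of `y⁻¹` are
`≤ [K:ℚ] (2M)^{[K:ℚ]} M^{[K:ℚ]}` (from `y (y^{e-1} + c_{e-1} y^{e-2} + ⋯ + c₁) = -c`). Used to
normalise the linear form (Baker 1975, p. 37: "`β'ⱼ = -βⱼ/βₙ` … have degrees at most `d²` and
heights at most `B' ≤ B^c`"). [cite: BakerTNT1975, Ch. 3 §4 (p. 37)] -/
theorem exists_den_inv {y : K} (hy : y ≠ 0) (hint : IsIntegral ℤ y) {M : ℝ} (hM1 : 1 ≤ M)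
    (hM : ∀ φ : K →+* ℂ, ‖φ y‖ ≤ M) :
    ∃ c : ℤ, c ≠ 0 ∧ |(c : ℝ)| ≤ (2 * M) ^ finrank ℚ K ∧ IsIntegral ℤ ((c : K) * y⁻¹) ∧
      ∀ φ : K →+* ℂ, ‖φ y⁻¹‖ ≤ finrank ℚ K * (2 * M) ^ finrank ℚ K * M ^ finrank ℚ K := by
  set D := finrank ℚ K with hD
  set m := minpoly ℤ y with hm
  set e := m.natDegree with he
  have hmQ : minpoly ℚ y = m.map (algebraMap ℤ ℚ) :=
    minpoly.isIntegrallyClosed_eq_field_fractions' ℚ hint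
  have hcoeff : ∀ i, |(m.coeff i : ℝ)| ≤ (2 * M) ^ D := abs_coeff_minpoly_int_le hint hM1 hM
  have hdeg : e ≤ D := natDegree_minpoly_int_le hint
  -- `c = m(0) ≠ 0`
  have hc0 : m.coeff 0 ≠ 0 := by
    intro h0
    have h1 : (minpoly ℚ y).coeff 0 ≠ 0 :=
      minpoly.coeff_zero_ne_zero (Algebra.IsIntegral.isIntegral (R := ℚ) y) hy
    rw [hmQ, coeff_map, h0, map_zero] at h1
    exact h1 rfl
  -- `w = ∑_{i<e} m_{i+1} y^i`, `y w = -c`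
  set w : K := ∑ i ∈ range e, ((m.coeff (i + 1) : ℤ) : K) * y ^ i with hw
  have hrel : y * w + (m.coeff 0 : K) = 0 := by
    have h1 : aeval y m = 0 := minpoly.aeval ℤ y
    rw [aeval_eq_sum_range, ← he, Finset.sum_range_succ'] at h1
    simp only [Algebra.smul_def, algebraMap_int_eq, eq_intCast, pow_zero, mul_one] at h1
    rw [hw, Finset.mul_sum]
    convert h1 using 2
    exact Finset.sum_congr rfl fun i _ => by ring
  have hinv : y⁻¹ = -w * ((m.coeff 0 : K))⁻¹ := by
    have hcK : ((m.coeff 0 : ℤ) : K) ≠ 0 := by exact_mod_cast hc0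
    field_simp
    linear_combination hrel
  have hcy : ((m.coeff 0 : ℤ) : K) * y⁻¹ = -w := by
    have hcK : ((m.coeff 0 : ℤ) : K) ≠ 0 := by exact_mod_cast hc0
    rw [hinv]; field_simp
  refine ⟨m.coeff 0, hc0, hcoeff 0, ?_, fun φ => ?_⟩
  · rw [hcy, hw]
    refine IsIntegral.neg (IsIntegral.sum _ fun i _ => ?_)
    exact (isIntegral_algebraMap (R := ℤ) (A := K) (x := m.coeff (i + 1))).mul (hint.pow _)
  · -- conjugates of `y⁻¹ = -w / c`
    have hc1 : (1 : ℝ) ≤ ‖φ ((m.coeff 0 : ℤ) : K)‖ := by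
      rw [map_intCast, Complex.norm_intCast]
      exact_mod_cast Int.one_le_abs hc0
    have hφw : ‖φ w‖ ≤ e * (2 * M) ^ D * M ^ D := by
      rw [hw, map_sum]
      calc ‖∑ i ∈ range e, φ (((m.coeff (i + 1) : ℤ) : K) * y ^ i)‖
          ≤ ∑ i ∈ range e, ‖φ (((m.coeff (i + 1) : ℤ) : K) * y ^ i)‖ := norm_sum_le _ _
        _ ≤ ∑ _i ∈ range e, (2 * M) ^ D * M ^ D := by
            refine Finset.sum_le_sum fun i hi => ?_
            rw [map_mul, map_pow, map_intCast, norm_mul, norm_pow, Complex.norm_intCast]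
            refine mul_le_mul (hcoeff _) ?_ (by positivity) (by positivity)
            exact (pow_le_pow_left₀ (norm_nonneg _) (hM φ) _).trans
              (pow_le_pow_right₀ hM1 ((Finset.mem_range.mp hi).le.trans hdeg))
        _ = e * (2 * M) ^ D * M ^ D := by
            rw [Finset.sum_const, Finset.card_range, nsmul_eq_mul]; ring
    have he' : (e : ℝ) ≤ D := by exact_mod_cast hdeg
    calc ‖φ y⁻¹‖ = ‖φ w‖ / ‖φ ((m.coeff 0 : ℤ) : K)‖ := by
          rw [hinv, map_mul, map_neg, map_inv₀, norm_mul, norm_neg, norm_inv, div_eq_mul_inv]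
      _ ≤ ‖φ w‖ := div_le_self (norm_nonneg _) hc1
      _ ≤ e * (2 * M) ^ D * M ^ D := hφw
      _ ≤ D * (2 * M) ^ D * M ^ D := by gcongr

end NumberField

/-! ### The degree of a field generated by elements with given integer polynomials -/

/-- **`[F(x, S) : F] ≤ deg P · [F(S) : F]`** for a non-zero `P ∈ F[X]` with `P(x) = 0`
(`F(x, S) = F(x) ⊔ F(S)` and Mathlib's `IntermediateField.finrank_sup_le`). [folklore] -/
theorem finrank_adjoin_insert_le {F E : Type*} [Field F] [Field E] [Algebra F E] (S : Set E)
    (x : E) {P : F[X]} (hP : P ≠ 0) (hx : aeval x P = 0) :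
    Module.finrank F (IntermediateField.adjoin F (insert x S)) ≤
      P.natDegree * Module.finrank F (IntermediateField.adjoin F S) := by
  have hxint : IsIntegral F x := (show IsAlgebraic F x from ⟨P, hP, hx⟩).isIntegral
  have h1 : Module.finrank F (IntermediateField.adjoin F {x}) ≤ P.natDegree := by
    rw [IntermediateField.adjoin.finrank hxint]
    exact natDegree_le_natDegree (minpoly.degree_le_of_ne_zero F x hP hx)
  rw [Set.insert_eq, IntermediateField.adjoin_union]
  exact (IntermediateField.finrank_sup_le _ _).trans (Nat.mul_le_mul_right _ h1)

/-- **`[F(x₁, …, x_m) : F] ≤ ∏ deg Pᵢ`** when `Pᵢ(xᵢ) = 0` with non-zero `Pᵢ ∈ F[X]` — the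
bound `d^{2n}` for the degree of `ℚ(α, β)` (Baker 1975, p. 34: "`Q` is an algebraic number with
degree at most `d^{2n}`"). [cite: BakerTNT1975, Ch. 3 §3 Lemma 5] -/
theorem finrank_adjoin_le_prod_natDegree {F E : Type*} [Field F] [Field E] [Algebra F E]
    {ι : Type*} [DecidableEq ι] (s : Finset ι) (x : ι → E) (P : ι → F[X])
    (hP : ∀ i ∈ s, P i ≠ 0) (hx : ∀ i ∈ s, aeval (x i) (P i) = 0) :
    Module.finrank F (IntermediateField.adjoin F (x '' (↑s : Set ι))) ≤ ∏ i ∈ s, (P i).natDegree := by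
  induction s using Finset.induction_on with
  | empty =>
    rw [Finset.coe_empty, Set.image_empty, IntermediateField.adjoin_empty, IntermediateField.finrank_bot,
      Finset.prod_empty]
  | insert a s has ih =>
    rw [Finset.coe_insert, Set.image_insert_eq, Finset.prod_insert has]
    have hPa : P a ≠ 0 := hP a (Finset.mem_insert_self a s)
    have hxa : aeval (x a) (P a) = 0 := hx a (Finset.mem_insert_self a s)
    have ih' := ih (fun i hi => hP i (Finset.mem_insert_of_mem hi))
      (fun i hi => hx i (Finset.mem_insert_of_mem hi))
    exact (finrank_adjoin_insert_le _ _ hPa hxa).trans (Nat.mul_le_mul_left _ ih')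

end Literature.NumberTheory.Transcendental.Baker1975.Ch3
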